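import Literature.NumberTheory.EllipticCurves.OggFormulaTwistTameIstarTwoProofs
import Literature.NumberTheory.EllipticCurves.NeronComponentIndexProofs
import HarnessLib

/-!
# Ogg's formula at `2` over `ℚ`: Kodaira type `II*` with `ord₂ Δ_min = 14` (`C₆`-branch) and `= 12` (all)

`Proofs` file (theorems only, no definitions, no named facts, no instances) in topic
`NumberTheory/EllipticCurves`, sequel of `OggFormulaTameTypesTwoProofs`,
`OggFormulaTwistTameTwoProofs` and `OggFormulaTwistTameIstarTwoProofs` (same seat: the C15 fact
`WeierstrassCurve.conductorNatOf_geomPoints_eq_conductorNorm_of_isElliptic W ℓ`, `HasseWeilAbelian`;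
Serre–Tate 1968 §3, Silverman *ATAEC* §IV.10 and Ogg's formula IV.11.1).

## Context

The leaf of Ogg–Saito left over `ℚ` is `Sw_𝔓(E[3]) = δ₂(E)` for the elliptic curves `E/ℚ` additive
at `2` with `ord₂(j) > 0`, `j ≠ 0`; the previous files of the series settle the tame curves (types
`IV`, `IV*`: `Φ = C₃`) and the `C₆`-branches `(II, 4)`, `(I₀*, 8)`, `(I₀*, 10)` (the twists by
`χ₋₁` of `IV`, by `χ₋₁` of `IV*`, by `χ_{±2}` of `IV`).  This file settles the `C₆`-branch of
**type `II*` with `ord₂ Δ_min = 14`**: the twists by `χ_{±2}` of the curves of type `IV*` whose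
`a₁/2` is even (`δ₂ = 4`; those with `a₁/2` odd are of type `I₄*` and are not treated here), and
the **whole branch `II*` with `ord₂ Δ_min = 12`**: every such curve is the twist by `χ₋₁` of a curve
with good reduction at `2` (`Φ = C₂`, `Sw = 2 = δ₂`), so that the C15 fact holds for it outright
(`conductorNatOf_geomPoints_eq_conductorNorm_of_isElliptic_of_IIstar_twelve`).

## The argument (Silverman *ATAEC* IV.9.4 Steps 6–10 with `π = 2`; Thm. IV.10.2(b), twist case)

* **Canonical normal form** (§1, over a DVR in which `2` is a uniformiser, perfect residue field).
  On the Step-10 model of a curve of type `II*` (`a₁ = 2α, a₂ = 4p, a₃ = 8γ, a₄ = 16q, a₆ = 32r`,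
  `r ∈ R^×`; the tree's `exists_smul_of_kodairaSymbolOfMinimal_eq_IIstar`) one has
  `Δ = 2¹¹(-rα⁶ + 2J)` and, if `2 ∣ α`, `Δ = 2¹²(-27γ⁴ + 2J')` (explicit polynomial identities), so
  `ord Δ = 14` forces `2 ∣ α` and `2 ∣ γ`; then `y ↦ y - a₃/2` kills `a₃`, and `x ↦ x + 4c`,
  `y ↦ y - 2c·a₁` with `c² ≡ a₄/16 (mod 2)` makes `32 ∣ a₄` keeping `a₃ = 0` and `a₆/32` a unit —
  the parity of `a₄/16` is *not* an invariant of the curve, the dichotomy `2¹⁰ ∣ b₈` /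
  `b₈ = 2⁹·unit` on the resulting models is (`…_of_addVal_eq_fourteen`).
* **`2¹⁰ ∣ b₈`** (§2, over `ℚ`).  On the `ℚ`-model (`exists_variableChange_valuation_shape_of_two`:
  `a₁ = 4α₁`, `a₂ = 4P`, `2⁶ ∣ a₃`, `a₄ = 32q`, `a₆ = 32r`) `2¹⁰ ∣ b₈` reads `α₁² + P ≡ 0 (mod 2)`;
  `r` is a `2`-adic unit, `≡ ε = ±1 (mod 4)`, and the twist by `2ε` under
  `(u; r, s, t) = (2; 0, 0, 16)` acquires the shape `a₁ = 0`, `4 ∣ a₂ = 2ε(α₁² + P)`, `a₃ = 4`,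
  `8 ∣ a₄`, `16 ∣ a₆ = 4ε(r - ε) + …`, `ord₂ Δ = 8` of type `IV*`; hence `E^{(2ε)}` is potentially
  good over `ℚ(∛2)` (`hasGoodReductionAt_baseChange_of_pow_three_eq`, `j = 2`) and
  `Sw_𝔓(V_ℓ E) = 2 · 2 = 4 = δ₂ = 14 - 10`
  (`swanConductorAt_rationalTate_eq_four_of_quadraticTwist_of_emod_four_eq_two`).
* **`ord₂ Δ_min = 12`** (§3).  On the Step-10 model `ord Δ = 12` forces `2 ∣ α` and `γ ∈ R^×`
  (`…_of_addVal_eq_twelve`); on the `ℚ`-model (`a₁ = 4α₁`, `a₂ = 4P`, `a₃ = 8γ`, `a₄ = 16q`,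
  `a₆ = 32r`, `γ, r` odd) the twist by `-1` under `(2; 0, 0, 4)` is
  `y² + y = x³ - (α₁² + P)x² + (q + α₁γ)x - ((γ² - 1) + 2(r + 1))/4`, `2`-integral with unit
  discriminant: good reduction at `2`.  Hence `Sw_𝔓(V_ℓ E) = 2 · 1 = 2 = δ₂ = 12 - 10` for *every*
  curve of the branch, and the C15 fact for these curves.

## Main results (over `ℚ`, `v ∋ 2`, `W` elliptic of Kodaira type `II*` at `v`, `ord₂ Δ_min = 14`)

* `LocalIndex.exists_smul_a_of_kodairaSymbolOfMinimal_eq_IIstar_of_two_of_addVal_eq_fourteen`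
  (DVR level), `WeierstrassCurve.Rat.valuation_sub_two_pow_le_or_of_valuation_eq` and
  `WeierstrassCurve.exists_variableChange_of_kodairaSymbolAt_IIstar_of_ordMinimalDiscriminant_eq_fourteen`
  (the dispatch over `ℚ`, with the `C₆` / non-`C₆` dichotomy on `b₈` and the sign of `a₆/32`);
* `WeierstrassCurve.swanConductorAt_rationalTate_eq_four_of_IIstar_fourteen_of_valuation_b₈_le`,
  `WeierstrassCurve.swanConductorAt_torsion_eq_wildConductorExponent_of_IIstar_fourteen_of_valuation_b₈_le`
  — `Sw_𝔓(V_ℓ E) = 4` and `Sw_𝔓(E[3]) = δ₂ = 4` on the `C₆`-branch of `(II*, 14)`;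
* `WeierstrassCurve.swanConductorAt_rationalTate_eq_two_of_IIstar_twelve`,
  `WeierstrassCurve.swanConductorAt_torsion_eq_wildConductorExponent_of_IIstar_twelve`,
  `WeierstrassCurve.conductorNatOf_geomPoints_eq_conductorNorm_of_isElliptic_of_IIstar_twelve`
  — `Sw = 2 = δ₂` and the C15 fact for every curve of type `II*` with `ord₂ Δ_min = 12`.

The complementary branch of `(II*, 14)` (`b₈ = 2⁹·unit`: inertia `SL₂(𝔽₃)`) and `(II*, 11)` are not
treated here.  No definitions, no named facts (D-0026).  All axioms `propext`, `Classical.choice`,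
`Quot.sound`.

## References

* J. H. Silverman, *Advanced Topics in the Arithmetic of Elliptic Curves*, GTM 151 (1994), IV.9.4
  (Tate's algorithm, Steps 6–10) and Table 4.1; §IV.10 (Definition of `ε, δ, f`, PDF p. 358;
  Thm. 10.2(b) and its proof, pp. 359–362); §IV.11 (Ogg's formula 11.1, p. 365; `p = 2`, p. 366).
  [SilvermanATAEC1994]
* J. H. Silverman, *The Arithmetic of Elliptic Curves*, 2nd ed. (2009), VII.1 Remark 1.1,
  VII.5 Prop. 5.4, X.5 Cor. 5.4. [SilvermanAEC2009]
* J.-P. Serre, J. Tate, *Good reduction of abelian varieties*, Ann. of Math. 88 (1968), §§2–3.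
  [SerreTate1968]
* T. Saito, *Conductor, discriminant, and the Noether formula of arithmetic surfaces*, Duke Math.
  J. 57 (1988), Theorem 1 (cited only). [Saito1988]

## Design

Theorems only; `noncomputable section`.  §1 in `namespace Literature.NumberTheory.EllipticCurves.LocalIndex`
(DVR level, `2` a uniformiser), polynomial identities by `ring`; §§2–3 over `ℚ` in
`namespace WeierstrassCurve`, with the signatures of `OggFormulaTwistTameIstarTwoProofs`.
Axioms: `propext`, `Classical.choice`, `Quot.sound`.
-/

noncomputable section

open scoped Classical NumberField
open NumberField IsDedekindDomain Field WithZero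


/-! ## §1. The canonical normal form of type `II*`, `ord Δ = 14`, when `2` is a uniformiser -/

section DVR

open IsLocalRing
open IsDiscreteValuationRing hiding maximalIdeal

namespace Literature.NumberTheory.EllipticCurves

namespace LocalIndex

open Literature.NumberTheory.DiophantineGeometry Literature.NumberTheory.DiophantineGeometry.TateAlgorithm
  Literature.NumberTheory.DiophantineGeometry.TateAlgorithm.CharTwo

variable {R : Type*} [CommRing R] [IsDomain R] [IsDiscreteValuationRing R]

omit [IsDomain R] [IsDiscreteValuationRing R] in
/-- **`Δ = 2¹¹(-rα⁶ + 2J)` on a Step-10 model** (`a₁ = 2α`, `a₂ = 4p`, `a₃ = 8γ`, `a₄ = 16q`,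
`a₆ = 32r`; explicit integral `J`).  So for type `II*` (`r ∈ R^×`): `ord Δ = 11` iff `α ∈ R^×`.
[folklore] -/
theorem Δ_eq_of_step10 (W : WeierstrassCurve R) {α p γ q r : R} (hα : W.a₁ = 2 * α)
    (hp : W.a₂ = 2 ^ 2 * p) (hγ : W.a₃ = 2 ^ 3 * γ) (hq : W.a₄ = 2 ^ 4 * q) (hr : W.a₆ = 2 ^ 5 * r) :
    W.Δ = 2 ^ 11 * (-(r * α ^ 6) + 2 *
      (-p * α ^ 4 * γ ^ 2 + q * α ^ 5 * γ + 8 * p * q * α ^ 3 * γ - 6 * p * r * α ^ 4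
       - 8 * p ^ 2 * α ^ 2 * γ ^ 2 + q ^ 2 * α ^ 4 + α ^ 3 * γ ^ 3 + 8 * p * q ^ 2 * α ^ 2
       + 36 * p * α * γ ^ 3 + 16 * p ^ 2 * q * α * γ - 24 * p ^ 2 * r * α ^ 2 - 16 * p ^ 3 * γ ^ 2
       - 30 * q * α ^ 2 * γ ^ 2 + 18 * r * α ^ 3 * γ + 72 * p * q * γ ^ 2 + 72 * p * r * α * γ
       + 16 * p ^ 2 * q ^ 2 - 32 * p ^ 3 * r + 36 * q * r * α ^ 2 - 96 * q ^ 2 * α * γ - 27 * γ ^ 4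
       + 144 * p * q * r - 64 * q ^ 3 - 108 * r * γ ^ 2 - 108 * r ^ 2)) := by
  simp only [WeierstrassCurve.Δ, WeierstrassCurve.b₂, WeierstrassCurve.b₄,
    WeierstrassCurve.b₆, WeierstrassCurve.b₈, hα, hp, hγ, hq, hr]
  ring

omit [IsDomain R] [IsDiscreteValuationRing R] in
/-- **`Δ = 2¹²(-27γ⁴ + 2J)` on a Step-10 model with `4 ∣ a₁`** (`a₁ = 4α₁`, `a₂ = 4p`, `a₃ = 8γ`,
`a₄ = 16q`, `a₆ = 32r`).  So `ord Δ = 12` iff `γ ∈ R^×`, and `ord Δ ≥ 13` forces `2 ∣ γ`. [folklore] -/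
theorem Δ_eq_of_step10_of_four_dvd_a₁ (W : WeierstrassCurve R) {α₁ p γ q r : R}
    (hα : W.a₁ = 2 ^ 2 * α₁) (hp : W.a₂ = 2 ^ 2 * p) (hγ : W.a₃ = 2 ^ 3 * γ) (hq : W.a₄ = 2 ^ 4 * q)
    (hr : W.a₆ = 2 ^ 5 * r) :
    W.Δ = 2 ^ 12 * (-(27 * γ ^ 4) + 2 *
      (-8 * p * α₁ ^ 4 * γ ^ 2 + 16 * q * α₁ ^ 5 * γ - 16 * r * α₁ ^ 6 + 32 * p * q * α₁ ^ 3 * γ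
       - 48 * p * r * α₁ ^ 4 - 16 * p ^ 2 * α₁ ^ 2 * γ ^ 2 + 8 * q ^ 2 * α₁ ^ 4 + 4 * α₁ ^ 3 * γ ^ 3
       + 16 * p * q ^ 2 * α₁ ^ 2 + 36 * p * α₁ * γ ^ 3 + 16 * p ^ 2 * q * α₁ * γ - 48 * p ^ 2 * r * α₁ ^ 2
       - 8 * p ^ 3 * γ ^ 2 - 60 * q * α₁ ^ 2 * γ ^ 2 + 72 * r * α₁ ^ 3 * γ + 36 * p * q * γ ^ 2
       + 72 * p * r * α₁ * γ + 8 * p ^ 2 * q ^ 2 - 16 * p ^ 3 * r + 72 * q * r * α₁ ^ 2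
       - 96 * q ^ 2 * α₁ * γ + 72 * p * q * r - 32 * q ^ 3 - 54 * r * γ ^ 2 - 54 * r ^ 2)) := by
  simp only [WeierstrassCurve.Δ, WeierstrassCurve.b₂, WeierstrassCurve.b₄,
    WeierstrassCurve.b₆, WeierstrassCurve.b₈, hα, hp, hγ, hq, hr]
  ring

/-- **Type `II*` with `ord Δ = 14` when `2` is a uniformiser: a canonical normal form.**  Some
`R`-model has `4 ∣ a₁, a₂`, `a₃ = 0`, `32 ∣ a₄`, `a₆ = 32r` with `r ∈ R^×`, and `b₈ = 512w` with the
dichotomy `2 ∣ w` (`2¹⁰ ∣ b₈`: `Φ = C₆`) or `w ∈ R^×`.  On the Step-10 model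
(`exists_smul_of_kodairaSymbolOfMinimal_eq_IIstar`: `a₁ = 2α`, `a₂ = 4p`, `a₃ = 8γ`, `a₄ = 16q`,
`a₆ = 32r`, `r` a unit) `ord Δ = 14` forces `2 ∣ α` (else `ord Δ = 11`, `Δ_eq_of_step10`) and
`2 ∣ γ` (else `ord Δ = 12`, `Δ_eq_of_step10_of_four_dvd_a₁`); `y ↦ y - a₃/2` kills `a₃`, and
`x ↦ x + 4c`, `y ↦ y - 2ca₁` with `c² ≡ a₄/16 (mod 2)` (perfect residue field) makes `32 ∣ a₄`,
keeping `a₃ = 0` and `a₆/32` a unit; then `b₈ = 512(α₁²r + pr - 2q₂²)`.  Silverman, *ATAEC*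
IV.9.4 Steps 6–10 with `π = 2`. [cite: SilvermanATAEC1994, IV.9.4 Steps 6–10] -/
theorem exists_smul_a_of_kodairaSymbolOfMinimal_eq_IIstar_of_two_of_addVal_eq_fourteen
    [PerfectField (ResidueField R)] (h2 : Irreducible (2 : R)) (V : WeierstrassCurve R)
    (hV : V.kodairaSymbolOfMinimal = .IIstar) (hΔ : (addVal R V.Δ).toNat = 14) :
    ∃ D : WeierstrassCurve.VariableChange R,
      2 ^ 2 ∣ (D • V).a₁ ∧ 2 ^ 2 ∣ (D • V).a₂ ∧ (D • V).a₃ = 0 ∧ 2 ^ 5 ∣ (D • V).a₄ ∧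
      (∃ r : R, IsUnit r ∧ (D • V).a₆ = 2 ^ 5 * r) ∧
      ((2 : R) ^ 10 ∣ (D • V).b₈ ∨ ∃ w : R, IsUnit w ∧ (D • V).b₈ = 2 ^ 9 * w) ∧
      (addVal R (D • V).Δ).toNat = 14 := by
  have hm : ∀ {x : R}, x ∈ maximalIdeal R ↔ (2 : R) ∣ x := fun {x} ↦
    mem_maximalIdeal_iff_dvd_of_irreducible h2 x
  have hmn : ∀ {x : R} {n : ℕ}, x ∈ maximalIdeal R ^ n ↔ (2 : R) ^ n ∣ x := fun {x n} ↦
    mem_maximalIdeal_pow_iff_dvd_of_irreducible h2 x n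
  obtain ⟨D₀, h₁, h₂, h₃, h₄, h₆, h₆'⟩ := exists_smul_of_kodairaSymbolOfMinimal_eq_IIstar V hV
  set N := D₀ • V with hN
  rw [hm] at h₁
  rw [hmn] at h₂ h₃ h₄ h₆ h₆'
  obtain ⟨α, hα⟩ := h₁
  obtain ⟨p, hp⟩ := h₂
  obtain ⟨γ, hγ⟩ := h₃
  obtain ⟨q, hq⟩ := h₄
  obtain ⟨r, hr⟩ := h₆
  have hru : IsUnit r := by
    rw [isUnit_iff_not_dvd h2]
    rintro ⟨r', rfl⟩
    exact h₆' ⟨r', by rw [hr]; ring⟩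
  have hordN : (addVal R N.Δ).toNat = 14 := by
    have : addVal R N.Δ = addVal R V.Δ := by
      rw [hN, WeierstrassCurve.variableChange_Δ, addVal_mul, addVal_pow, addVal_eq_zero_of_unit,
        nsmul_zero, zero_add]
    rw [this, hΔ]
  -- `2 ∣ α`
  have hαd : (2 : R) ∣ α := by
    by_contra hαu
    rw [← isUnit_iff_not_dvd h2] at hαu
    have := addVal_toNat_eq_of_two h2 ((hru.mul (hαu.pow 6)).neg) (Δ_eq_of_step10 N hα hp hγ hq hr)
    omega
  obtain ⟨α₁, rfl⟩ := hαd
  have hα' : N.a₁ = 2 ^ 2 * α₁ := by rw [hα]; ring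
  -- `2 ∣ γ`
  have h27 : IsUnit (27 : R) := by
    have := isUnit_add_mul_of_isUnit h2 isUnit_one (13 : R)
    rwa [show (1 : R) + 2 * 13 = 27 by norm_num] at this
  have hγd : (2 : R) ∣ γ := by
    by_contra hγu
    rw [← isUnit_iff_not_dvd h2] at hγu
    have := addVal_toNat_eq_of_two h2 ((h27.mul (hγu.pow 4)).neg)
      (Δ_eq_of_step10_of_four_dvd_a₁ N hα' hp hγ hq hr)
    omega
  obtain ⟨γ₁, rfl⟩ := hγd
  have hγ' : N.a₃ = 2 ^ 4 * γ₁ := by rw [hγ]; ring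
  -- kill `a₃`: `y ↦ y - 8γ₁`
  set C₁ : WeierstrassCurve.VariableChange R := ⟨1, 0, 0, -(8 * γ₁)⟩ with hC₁
  set N₁ := C₁ • N with hN₁
  have f₁ : N₁.a₁ = 2 ^ 2 * α₁ := by
    rw [hN₁, WeierstrassCurve.variableChange_a₁, hC₁, hα']; simp
  have f₂ : N₁.a₂ = 2 ^ 2 * p := by
    rw [hN₁, WeierstrassCurve.variableChange_a₂, hC₁, hp, hα']; simp
  have f₃ : N₁.a₃ = 0 := by
    rw [hN₁, WeierstrassCurve.variableChange_a₃, hC₁, hγ', hα']; simp; ring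
  have f₄ : N₁.a₄ = 2 ^ 4 * (q + 2 * α₁ * γ₁) := by
    rw [hN₁, WeierstrassCurve.variableChange_a₄, hC₁, hq, hγ', hp, hα']; simp; ring
  have f₆ : N₁.a₆ = 2 ^ 5 * (r + 2 * γ₁ ^ 2) := by
    rw [hN₁, WeierstrassCurve.variableChange_a₆, hC₁, hr, hq, hγ', hp, hα']; simp; ring
  have hΔ₁ : N₁.Δ = N.Δ := by rw [hN₁]; exact Δ_smul_of_u_eq_one rfl N
  set q₁ := q + 2 * α₁ * γ₁ with hq₁
  set r₁ := r + 2 * γ₁ ^ 2 with hr₁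
  have hr₁u : IsUnit r₁ := isUnit_add_mul_of_isUnit h2 hru _
  -- `c` with `c² ≡ q₁ (mod 2)`
  have hres : (0 : ResidueField R) ^ 2 + 4 * residue R q₁ = 0 := by
    rw [residue_four_eq_zero h2]; ring
  obtain ⟨σ, -, hσ⟩ := exists_root_step6 _ _ hres
  obtain ⟨c, rfl⟩ := residue_surjective σ
  have hcq : (2 : R) ∣ (q₁ - c ^ 2) := by
    rw [← hm, ← residue_eq_zero_iff, map_sub, map_pow]
    rw [zero_mul, add_zero] at hσ
    rw [show residue R q₁ - residue R c ^ 2 = -(residue R c ^ 2 - residue R q₁) by ring, hσ, neg_zero]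
  obtain ⟨e, he⟩ := hcq
  -- `x ↦ x + 4c`, `y ↦ y - 8cα₁`
  set C₂ : WeierstrassCurve.VariableChange R := ⟨1, 4 * c, 0, -(8 * c * α₁)⟩ with hC₂
  set N₂ := C₂ • N₁ with hN₂
  have g₁ : N₂.a₁ = 2 ^ 2 * α₁ := by
    rw [hN₂, WeierstrassCurve.variableChange_a₁, hC₂, f₁]; simp
  have g₂ : N₂.a₂ = 2 ^ 2 * (p + 3 * c) := by
    rw [hN₂, WeierstrassCurve.variableChange_a₂, hC₂, f₂, f₁]; simp; ring
  have g₃ : N₂.a₃ = 0 := by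
    rw [hN₂, WeierstrassCurve.variableChange_a₃, hC₂, f₃, f₁]; simp; ring
  have g₄ : N₂.a₄ = 2 ^ 5 * (e + 2 * c ^ 2 + c * p + c * α₁ ^ 2) := by
    rw [hN₂, WeierstrassCurve.variableChange_a₄, hC₂, f₄, f₃, f₂, f₁]; simp
    linear_combination (16 : R) * he
  have g₆ : N₂.a₆ = 2 ^ 5 * (r₁ + 2 * (c * q₁ + c ^ 2 * p + c ^ 3 + c ^ 2 * α₁ ^ 2)) := by
    rw [hN₂, WeierstrassCurve.variableChange_a₆, hC₂, f₆, f₄, f₃, f₂, f₁]; simp; ring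
  have hΔ₂ : N₂.Δ = N₁.Δ := by rw [hN₂]; exact Δ_smul_of_u_eq_one rfl N₁
  have hordN₂ : (addVal R N₂.Δ).toNat = 14 := by rw [hΔ₂, hΔ₁, hordN]
  set p₂ := p + 3 * c with hp₂
  set q₂ := e + 2 * c ^ 2 + c * p + c * α₁ ^ 2 with hq₂
  set r₂ := r₁ + 2 * (c * q₁ + c ^ 2 * p + c ^ 3 + c ^ 2 * α₁ ^ 2) with hr₂
  have hr₂u : IsUnit r₂ := isUnit_add_mul_of_isUnit h2 hr₁u _
  have hb₈ : N₂.b₈ = 2 ^ 9 * (α₁ ^ 2 * r₂ + p₂ * r₂ - 2 * q₂ ^ 2) := by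
    rw [WeierstrassCurve.b₈, g₁, g₂, g₃, g₄, g₆]; ring
  have hb₈' : (2 : R) ^ 10 ∣ N₂.b₈ ∨ ∃ w : R, IsUnit w ∧ N₂.b₈ = 2 ^ 9 * w := by
    by_cases hw : IsUnit (α₁ ^ 2 * r₂ + p₂ * r₂ - 2 * q₂ ^ 2)
    · exact Or.inr ⟨_, hw, hb₈⟩
    · obtain ⟨w₁, hw₁⟩ := (not_isUnit_iff_dvd h2 _).mp hw
      exact Or.inl ⟨w₁, by rw [hb₈, hw₁]; ring⟩
  refine ⟨C₂ * C₁ * D₀, ?_⟩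
  rw [mul_smul, mul_smul, ← hN, ← hN₁, ← hN₂]
  exact ⟨⟨α₁, g₁⟩, ⟨_, g₂⟩, g₃, ⟨_, g₄⟩, ⟨_, hr₂u, g₆⟩, hb₈', hordN₂⟩

/-- **Type `II*` with `ord Δ = 12` when `2` is a uniformiser: a canonical normal form.**  Some
`R`-model has `4 ∣ a₁, a₂`, `a₃ = 8γ` with `γ ∈ R^×`, `16 ∣ a₄`, `a₆ = 32r` with `r ∈ R^×`: on the
Step-10 model `ord Δ = 12` forces `2 ∣ a₁/2` (else `ord Δ = 11`, `Δ_eq_of_step10`) and then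
`a₃/8 ∈ R^×` (else `2¹³ ∣ Δ`, `Δ_eq_of_step10_of_four_dvd_a₁`).  Silverman, *ATAEC* IV.9.4
Steps 6–10 with `π = 2` (Table 4.1: over `ℚ₂`, type `II*` with `f = 4`).
[cite: SilvermanATAEC1994, IV.9.4 Steps 6–10] -/
theorem exists_smul_a_of_kodairaSymbolOfMinimal_eq_IIstar_of_two_of_addVal_eq_twelve
    [PerfectField (ResidueField R)] (h2 : Irreducible (2 : R)) (V : WeierstrassCurve R)
    (hV : V.kodairaSymbolOfMinimal = .IIstar) (hΔ : (addVal R V.Δ).toNat = 12) :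
    ∃ D : WeierstrassCurve.VariableChange R,
      2 ^ 2 ∣ (D • V).a₁ ∧ 2 ^ 2 ∣ (D • V).a₂ ∧ (∃ γ : R, IsUnit γ ∧ (D • V).a₃ = 2 ^ 3 * γ) ∧
      2 ^ 4 ∣ (D • V).a₄ ∧ (∃ r : R, IsUnit r ∧ (D • V).a₆ = 2 ^ 5 * r) ∧
      (addVal R (D • V).Δ).toNat = 12 := by
  have hm : ∀ {x : R}, x ∈ maximalIdeal R ↔ (2 : R) ∣ x := fun {x} ↦
    mem_maximalIdeal_iff_dvd_of_irreducible h2 x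
  have hmn : ∀ {x : R} {n : ℕ}, x ∈ maximalIdeal R ^ n ↔ (2 : R) ^ n ∣ x := fun {x n} ↦
    mem_maximalIdeal_pow_iff_dvd_of_irreducible h2 x n
  obtain ⟨D₀, h₁, h₂', h₃, h₄, h₆, h₆'⟩ := exists_smul_of_kodairaSymbolOfMinimal_eq_IIstar V hV
  set N := D₀ • V with hN
  rw [hm] at h₁
  rw [hmn] at h₂' h₃ h₄ h₆ h₆'
  obtain ⟨α, hα⟩ := h₁
  obtain ⟨p, hp⟩ := h₂'
  obtain ⟨γ, hγ⟩ := h₃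
  obtain ⟨q, hq⟩ := h₄
  obtain ⟨r, hr⟩ := h₆
  have hru : IsUnit r := by
    rw [isUnit_iff_not_dvd h2]
    rintro ⟨r', rfl⟩
    exact h₆' ⟨r', by rw [hr]; ring⟩
  have hordN : (addVal R N.Δ).toNat = 12 := by
    have : addVal R N.Δ = addVal R V.Δ := by
      rw [hN, WeierstrassCurve.variableChange_Δ, addVal_mul, addVal_pow, addVal_eq_zero_of_unit,
        nsmul_zero, zero_add]
    rw [this, hΔ]
  have hN0 : N.Δ ≠ 0 := by
    intro h0; rw [h0] at hordN; simp at hordN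
  -- `2 ∣ α`
  have hαd : (2 : R) ∣ α := by
    by_contra hαu
    rw [← isUnit_iff_not_dvd h2] at hαu
    have := addVal_toNat_eq_of_two h2 ((hru.mul (hαu.pow 6)).neg) (Δ_eq_of_step10 N hα hp hγ hq hr)
    omega
  obtain ⟨α₁, rfl⟩ := hαd
  have hα' : N.a₁ = 2 ^ 2 * α₁ := by rw [hα]; ring
  -- `γ` is a unit
  have hγu : IsUnit γ := by
    rw [isUnit_iff_not_dvd h2]
    rintro ⟨γ₁, rfl⟩
    have h13 : (2 : R) ^ 13 ∣ N.Δ := by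
      rw [Δ_eq_of_step10_of_four_dvd_a₁ N hα' hp hγ hq hr]
      exact ⟨-(27 * 8 * γ₁ ^ 4) + (-8 * p * α₁ ^ 4 * (2 * γ₁) ^ 2 + 16 * q * α₁ ^ 5 * (2 * γ₁)
        - 16 * r * α₁ ^ 6 + 32 * p * q * α₁ ^ 3 * (2 * γ₁)
        - 48 * p * r * α₁ ^ 4 - 16 * p ^ 2 * α₁ ^ 2 * (2 * γ₁) ^ 2 + 8 * q ^ 2 * α₁ ^ 4
        + 4 * α₁ ^ 3 * (2 * γ₁) ^ 3
        + 16 * p * q ^ 2 * α₁ ^ 2 + 36 * p * α₁ * (2 * γ₁) ^ 3 + 16 * p ^ 2 * q * α₁ * (2 * γ₁)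
        - 48 * p ^ 2 * r * α₁ ^ 2
        - 8 * p ^ 3 * (2 * γ₁) ^ 2 - 60 * q * α₁ ^ 2 * (2 * γ₁) ^ 2 + 72 * r * α₁ ^ 3 * (2 * γ₁)
        + 36 * p * q * (2 * γ₁) ^ 2
        + 72 * p * r * α₁ * (2 * γ₁) + 8 * p ^ 2 * q ^ 2 - 16 * p ^ 3 * r + 72 * q * r * α₁ ^ 2
        - 96 * q ^ 2 * α₁ * (2 * γ₁) + 72 * p * q * r - 32 * q ^ 3 - 54 * r * (2 * γ₁) ^ 2 - 54 * r ^ 2),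
        by ring⟩
    have := le_addVal_toNat_of_pow_dvd h2 hN0 h13
    omega
  exact ⟨D₀, ⟨α₁, hα'⟩, ⟨p, hp⟩, ⟨γ, hγu, hγ⟩, ⟨q, hq⟩, ⟨r, hru, hr⟩, hordN⟩

end LocalIndex

end Literature.NumberTheory.EllipticCurves

end DVR

/-! ## §2. Over `ℚ`: the `C₆`-branch of type `II*`, `ord₂ Δ_min = 14` -/

namespace WeierstrassCurve

open Literature.NumberTheory.EllipticCurves Literature.NumberTheory.GaloisRepresentations
  IsDedekindDomain.HeightOneSpectrum Rat.HeightOneSpectrum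

/-- At a place above `2` of `ℚ`: `2ᵏ·(2-adic unit)` is `≡ 2ᵏ` or `≡ -2ᵏ (mod 2ᵏ⁺²)`. [folklore] -/
theorem Rat.valuation_sub_two_pow_le_or_of_valuation_eq {v : HeightOneSpectrum (𝓞 ℚ)}
    (hv : (2 : 𝓞 ℚ) ∈ v.asIdeal) (k : ℕ) {x : ℚ} (hx : v.valuation ℚ x = exp (-(k : ℤ))) :
    v.valuation ℚ (x - 2 ^ k) ≤ exp (-(k + 2 : ℤ)) ∨ v.valuation ℚ (x + 2 ^ k) ≤ exp (-(k + 2 : ℤ)) := by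
  have hv2 : natGenerator v = 2 := Rat.natGenerator_eq_two hv
  have hval : ∀ y : ℚ, v.valuation ℚ y = Valued.v (algebraMap ℚ (v.adicCompletion ℚ) y) := fun y ↦ by
    rw [valued_algebraMap_adicCompletion]
  have V2 : Valued.v (2 : v.adicCompletion ℚ) = exp (-1 : ℤ) := valued_two v hv2
  have h20 : (2 : v.adicCompletion ℚ) ≠ 0 := by
    intro h; rw [h, Valuation.map_zero] at V2; exact exp_ne_zero V2.symm
  have Vk : Valued.v ((2 : v.adicCompletion ℚ) ^ k) = exp (-(k : ℤ)) := by
    rw [Valuation.map_pow, V2, ← exp_nsmul]; simp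
  set r : v.adicCompletion ℚ := algebraMap ℚ _ x / 2 ^ k with hr
  have hrv : Valued.v r = 1 := by
    rw [hr, map_div₀, Vk, div_eq_iff exp_ne_zero, one_mul, ← hval, hx]
  have hx' : algebraMap ℚ (v.adicCompletion ℚ) x = 2 ^ k * r := by
    rw [hr, mul_div_cancel₀ _ (pow_ne_zero k h20)]
  have hr1 : Valued.v (r - 1) ≤ exp (-1 : ℤ) :=
    valued_le_exp_neg_one_of_lt_one v
      ((valued_lt_one_or_valued_sub_one_lt_one v hv2 hrv.le).resolve_left (by rw [hrv]; exact lt_irrefl 1))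
  set ρ : v.adicCompletion ℚ := (r - 1) / 2 with hρ
  have hρv : Valued.v ρ ≤ 1 := by
    rw [hρ, map_div₀, V2, div_le_iff₀ (zero_lt_iff.mpr exp_ne_zero), one_mul]; exact hr1
  have hrρ : r - 1 = 2 * ρ := by rw [hρ, mul_div_cancel₀ _ h20]
  have key : ∀ {y : v.adicCompletion ℚ}, Valued.v y ≤ exp (-1 : ℤ) →
      Valued.v (2 ^ k * (2 * y)) ≤ exp (-(k + 2 : ℤ)) := by
    intro y hy
    rw [Valuation.map_mul, Valuation.map_mul, Vk, V2, ← mul_assoc, ← exp_add]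
    exact (mul_le_mul' le_rfl hy).trans (by rw [← exp_add, exp_le_exp]; omega)
  have h2k : algebraMap ℚ (v.adicCompletion ℚ) (2 ^ k) = 2 ^ k := by rw [map_pow, map_ofNat]
  rcases valued_lt_one_or_valued_sub_one_lt_one v hv2 hρv with h | h
  · left
    rw [hval, map_sub, h2k, hx', show (2 : v.adicCompletion ℚ) ^ k * r - 2 ^ k = 2 ^ k * (r - 1) by ring,
      hrρ]
    exact key (valued_le_exp_neg_one_of_lt_one v h)
  · right
    rw [hval, map_add, h2k, hx',
      show (2 : v.adicCompletion ℚ) ^ k * r + 2 ^ k = 2 ^ k * ((r - 1) + 2) by ring, hrρ,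
      show (2 : v.adicCompletion ℚ) * ρ + 2 = 2 * ((ρ - 1) + 2) by ring]
    exact key (Valuation.map_add_le _ (valued_le_exp_neg_one_of_lt_one v h) V2.le)

variable (X : WeierstrassCurve ℚ)

/-- **The twist by `2ε` of a `C₆`-curve of type `II*`, `ord₂ Δ = 14`, with `a₆ ≡ 32ε (mod 128)`, has
the shape of type `IV*` after rescaling.**  Let `X/ℚ` have `ord₂(a₁) ≥ 2`, `ord₂(a₂) ≥ 2`,
`ord₂(a₃) ≥ 6`, `ord₂(a₄) ≥ 5`, `ord₂(a₆) = 5`, `ord₂(a₆ - 32ε) ≥ 7` (`ε = ±1`), `ord₂(b₈) ≥ 10` and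
`ord₂(Δ) = 14`.  Write `a₁ = 4α₁`, `a₂ = 4P`, `a₃ = 64θ`, `a₄ = 32q`, `a₆ = 32r` (`r ≡ ε (mod 4)`);
`b₈ = 2⁹(r(α₁² + P) - 2⁴α₁θq + 2⁵Pθ² - 2q²)`, so `2¹⁰ ∣ b₈` gives `α₁² + P ≡ 0 (mod 2)`.  The twist
`X^{(2ε)}` has `a₂ = 8ε(α₁² + P)`, `a₄ = 2⁷(q + 4α₁θ)`, `a₆ = 2⁸(εr + 32εθ²)`, `Δ = 2⁶Δ(X)`, and under
`(u; r, s, t) = (2; 0, 0, 16)` it becomes `a₁' = 0`, `a₂' = 2ε(α₁² + P)`, `a₃' = 4`,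
`a₄' = 8(q + 4α₁θ)`, `a₆' = 4(ε(r - ε) + 32εθ²)`, `Δ' = Δ/2⁶`: the shape `(ord aᵢ) ≥ (1, 2, 2, 3, 4)`,
`ord Δ = 8` of Kodaira type `IV*`.
[cite: SilvermanATAEC1994, IV.9.4 Steps 6–8 and Table 4.1] [cite: SilvermanAEC2009, X.5 Cor. 5.4] -/
theorem exists_variableChange_quadraticTwist_two_mul_of_IIstar_fourteen_of_valuation_b₈_le
    {v : HeightOneSpectrum (𝓞 ℚ)} (hv : (2 : 𝓞 ℚ) ∈ v.asIdeal) {ε : ℤ} (hε : ε = 1 ∨ ε = -1)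
    (h₁ : v.valuation ℚ X.a₁ ≤ exp (-2 : ℤ)) (h₂ : v.valuation ℚ X.a₂ ≤ exp (-2 : ℤ))
    (h₃ : v.valuation ℚ X.a₃ ≤ exp (-6 : ℤ)) (h₄ : v.valuation ℚ X.a₄ ≤ exp (-5 : ℤ))
    (h₆ : v.valuation ℚ X.a₆ = exp (-5 : ℤ)) (h₆ε : v.valuation ℚ (X.a₆ - 32 * ε) ≤ exp (-7 : ℤ))
    (h₈ : v.valuation ℚ X.b₈ ≤ exp (-10 : ℤ)) (hΔ : v.valuation ℚ X.Δ = exp (-14 : ℤ)) :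
    ∃ C : VariableChange ℚ,
      v.valuation ℚ (C • X.quadraticTwist (2 * ε)).a₁ ≤ exp (-(1 : ℕ) : ℤ) ∧
      v.valuation ℚ (C • X.quadraticTwist (2 * ε)).a₂ ≤ exp (-(2 : ℕ) : ℤ) ∧
      v.valuation ℚ (C • X.quadraticTwist (2 * ε)).a₃ ≤ exp (-(2 : ℕ) : ℤ) ∧
      v.valuation ℚ (C • X.quadraticTwist (2 * ε)).a₄ ≤ exp (-(3 : ℕ) : ℤ) ∧
      v.valuation ℚ (C • X.quadraticTwist (2 * ε)).a₆ ≤ exp (-(4 : ℕ) : ℤ) ∧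
      v.valuation ℚ (C • X.quadraticTwist (2 * ε)).Δ = exp (-(8 : ℕ) : ℤ) := by
  have hv2 : natGenerator v = 2 := Rat.natGenerator_eq_two hv
  set Kv := v.adicCompletion ℚ with hKv
  set φ := algebraMap ℚ Kv with hφ
  have hval : ∀ x : ℚ, v.valuation ℚ x = Valued.v (φ x) := fun x ↦ by
    rw [hφ, valued_algebraMap_adicCompletion]
  have V2 : Valued.v (2 : Kv) = exp (-1 : ℤ) := valued_two v hv2
  have h20 : (2 : Kv) ≠ 0 := by
    intro h; rw [h, Valuation.map_zero] at V2; exact exp_ne_zero V2.symm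
  have hpow : ∀ n : ℕ, Valued.v ((2 : Kv) ^ n) = exp (-(n : ℤ)) := fun n ↦ by
    rw [Valuation.map_pow, V2, ← exp_nsmul]; simp
  have hpow0 : ∀ n : ℕ, ((2 : Kv) ^ n) ≠ 0 := fun n ↦ pow_ne_zero n h20
  have hexp : ∀ {a b : ℤ}, a ≤ b → exp a ≤ exp b := fun h ↦ exp_le_exp.mpr h
  have hscale : ∀ {x : Kv} (n : ℕ) {g : WithZero (Multiplicative ℤ)},
      Valued.v (2 ^ n * x) ≤ exp (-(n : ℤ)) * g → Valued.v x ≤ g := by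
    intro x n g h
    rw [show Valued.v x = Valued.v (2 ^ n * x) / exp (-(n : ℤ)) by
      rw [Valuation.map_mul, hpow, mul_div_cancel_left₀ _ exp_ne_zero],
      div_le_iff₀ (zero_lt_iff.mpr exp_ne_zero)]
    exact h.trans_eq (mul_comm _ _)
  have hscale' : ∀ {x : Kv} (n : ℕ) {g : WithZero (Multiplicative ℤ)},
      Valued.v (2 ^ n * x) = exp (-(n : ℤ)) * g → Valued.v x = g := by
    intro x n g h
    rw [show Valued.v x = Valued.v (2 ^ n * x) / exp (-(n : ℤ)) by
      rw [Valuation.map_mul, hpow, mul_div_cancel_left₀ _ exp_ne_zero],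
      div_eq_iff exp_ne_zero]
    exact h.trans (mul_comm _ _)
  have hεK : (ε : Kv) ^ 2 = 1 := by
    rcases hε with rfl | rfl <;> norm_num
  have hεv : Valued.v (ε : Kv) = 1 := by
    rcases hε with rfl | rfl <;> simp
  -- `a₁ = 4α₁`, `a₂ = 4P`, `a₃ = 64θ`, `a₄ = 32q`, `a₆ = 32r`
  set α₁ : Kv := φ X.a₁ / 2 ^ 2 with hα₁
  set P : Kv := φ X.a₂ / 2 ^ 2 with hP
  set θ : Kv := φ X.a₃ / 2 ^ 6 with hθ
  set q : Kv := φ X.a₄ / 2 ^ 5 with hq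
  set r : Kv := φ X.a₆ / 2 ^ 5 with hr
  have ha₁ : φ X.a₁ = 2 ^ 2 * α₁ := by rw [hα₁, mul_div_cancel₀ _ (hpow0 2)]
  have ha₂ : φ X.a₂ = 2 ^ 2 * P := by rw [hP, mul_div_cancel₀ _ (hpow0 2)]
  have ha₃ : φ X.a₃ = 2 ^ 6 * θ := by rw [hθ, mul_div_cancel₀ _ (hpow0 6)]
  have ha₄ : φ X.a₄ = 2 ^ 5 * q := by rw [hq, mul_div_cancel₀ _ (hpow0 5)]
  have ha₆ : φ X.a₆ = 2 ^ 5 * r := by rw [hr, mul_div_cancel₀ _ (hpow0 5)]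
  have hα₁v : Valued.v α₁ ≤ 1 := hscale 2 (by rw [← ha₁, ← hval, mul_one]; exact h₁)
  have hPv : Valued.v P ≤ 1 := hscale 2 (by rw [← ha₂, ← hval, mul_one]; exact h₂)
  have hθv : Valued.v θ ≤ 1 := hscale 6 (by rw [← ha₃, ← hval, mul_one]; exact h₃)
  have hqv : Valued.v q ≤ 1 := hscale 5 (by rw [← ha₄, ← hval, mul_one]; exact h₄)
  have hrv : Valued.v r = 1 := hscale' 5 (by rw [← ha₆, ← hval, mul_one]; exact h₆)
  -- the sign: `v(r - ε) ≥ 2`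
  have hrε : Valued.v (r - ε) ≤ exp (-2 : ℤ) := by
    refine hscale 5 ?_
    have e : (2 : Kv) ^ 5 * (r - ε) = φ (X.a₆ - 32 * ε) := by
      rw [map_sub, map_mul, map_ofNat, map_intCast, ha₆]; ring
    rw [e, ← hval, ← exp_add]
    exact h₆ε.trans (hexp (by norm_num))
  -- `α₁² + P ∈ 2𝓞` from `2¹⁰ ∣ b₈ = 2⁹(r(α₁² + P) - 2⁴α₁θq + 2⁵Pθ² - 2q²)`
  set w : Kv := φ X.b₈ / 2 ^ 9 with hw
  have hb₈w : φ X.b₈ = 2 ^ 9 * w := by rw [hw, mul_div_cancel₀ _ (hpow0 9)]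
  have hwv : Valued.v w ≤ exp (-1 : ℤ) :=
    hscale 9 (by rw [← hb₈w, ← hval, ← exp_add]; exact h₈.trans (hexp (by norm_num)))
  have hexpand : φ X.b₈ = (φ X.a₁) ^ 2 * φ X.a₆ + 4 * φ X.a₂ * φ X.a₆ - φ X.a₁ * φ X.a₃ * φ X.a₄ +
      φ X.a₂ * (φ X.a₃) ^ 2 - (φ X.a₄) ^ 2 := by
    simp only [WeierstrassCurve.b₈, map_add, map_sub, map_mul, map_pow, map_ofNat]
  rw [ha₁, ha₂, ha₃, ha₄, ha₆] at hexpand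
  have hid : r * (α₁ ^ 2 + P) = w + 2 ^ 4 * α₁ * θ * q - 2 ^ 5 * P * θ ^ 2 + 2 * q ^ 2 := by
    apply mul_left_cancel₀ (hpow0 9)
    linear_combination hexpand.symm.trans hb₈w
  have hαP : Valued.v (α₁ ^ 2 + P) ≤ exp (-1 : ℤ) := by
    have : Valued.v (r * (α₁ ^ 2 + P)) ≤ exp (-1 : ℤ) := by
      rw [hid]
      refine Valuation.map_add_le _ (Valuation.map_sub_le _ (Valuation.map_add_le _ hwv ?_) ?_) ?_
      · rw [Valuation.map_mul, Valuation.map_mul, Valuation.map_mul, hpow]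
        calc exp (-((4 : ℕ) : ℤ)) * Valued.v α₁ * Valued.v θ * Valued.v q
            ≤ exp (-((4 : ℕ) : ℤ)) * 1 * 1 * 1 :=
              mul_le_mul' (mul_le_mul' (mul_le_mul' le_rfl hα₁v) hθv) hqv
          _ ≤ exp (-1 : ℤ) := by rw [mul_one, mul_one, mul_one]; exact hexp (by norm_num)
      · rw [Valuation.map_mul, Valuation.map_mul, hpow, Valuation.map_pow]
        calc exp (-((5 : ℕ) : ℤ)) * Valued.v P * Valued.v θ ^ 2 ≤ exp (-((5 : ℕ) : ℤ)) * 1 * 1 ^ 2 :=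
              mul_le_mul' (mul_le_mul' le_rfl hPv) (pow_le_pow_left' hθv 2)
          _ ≤ exp (-1 : ℤ) := by rw [mul_one, one_pow, mul_one]; exact hexp (by norm_num)
      · rw [Valuation.map_mul, V2, Valuation.map_pow]
        exact (mul_le_mul' le_rfl (pow_le_one' hqv 2)).trans (by rw [mul_one])
    rwa [Valuation.map_mul, hrv, one_mul] at this
  -- the coefficients of `Xd = X.quadraticTwist (2ε)` in `K_v`
  set Xd := X.quadraticTwist (2 * ε) with hXd
  have hA₁ : Xd.a₁ = 0 := rfl
  have hA₃ : Xd.a₃ = 0 := rfl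
  have h4Q : (4 : ℚ) ≠ 0 := by norm_num
  have h2Q : (2 : ℚ) ≠ 0 := two_ne_zero
  have hA₂ : φ Xd.a₂ = 2 ^ 3 * (ε * (α₁ ^ 2 + P)) := by
    have e : 4 * Xd.a₂ = (2 * ε) * X.b₂ := by
      rw [hXd, quadraticTwist_a₂, mul_div_cancel₀ _ h4Q]
    have e' := congrArg φ e
    simp only [WeierstrassCurve.b₂, map_mul, map_add, map_pow, map_ofNat, map_intCast] at e'
    rw [ha₁, ha₂] at e'
    apply mul_left_cancel₀ (hpow0 2)
    linear_combination e'
  have hA₄ : φ Xd.a₄ = 2 ^ 7 * (q + 2 ^ 2 * α₁ * θ) := by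
    have e : 2 * Xd.a₄ = (2 * ε) ^ 2 * X.b₄ := by
      rw [hXd, quadraticTwist_a₄, mul_div_cancel₀ _ h2Q]
    have e' := congrArg φ e
    simp only [WeierstrassCurve.b₄, map_mul, map_add, map_pow, map_ofNat, map_intCast] at e'
    rw [ha₁, ha₃, ha₄] at e'
    apply mul_left_cancel₀ h20
    linear_combination e' + (2 * (2 ^ 5 * q) + 2 ^ 2 * α₁ * (2 ^ 6 * θ)) * (4 : Kv) * hεK
  have hA₆ : φ Xd.a₆ = 2 ^ 8 * (ε * r + 2 ^ 5 * ε * θ ^ 2) := by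
    have e : 4 * Xd.a₆ = (2 * ε) ^ 3 * X.b₆ := by
      rw [hXd, quadraticTwist_a₆, mul_div_cancel₀ _ h4Q]
    have e' := congrArg φ e
    simp only [WeierstrassCurve.b₆, map_mul, map_add, map_pow, map_ofNat, map_intCast] at e'
    rw [ha₃, ha₆] at e'
    apply mul_left_cancel₀ (hpow0 2)
    linear_combination e' + (2 * ε * ((2 ^ 6 * θ) ^ 2 + 4 * (2 ^ 5 * r))) * (4 : Kv) * hεK
  have hΔd : φ Xd.Δ = 2 ^ 6 * φ X.Δ := by
    rw [hXd, quadraticTwist_Δ, map_mul, map_pow, map_mul, map_ofNat, map_intCast, mul_pow,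
      show ((ε : Kv)) ^ 6 = ((ε : Kv) ^ 2) ^ 3 by ring, hεK]
    ring
  -- the change of variables `(2; 0, 0, 16)`
  set u₂ : ℚˣ := Units.mk0 2 h2Q with hu₂
  have hu₂inv : ((u₂⁻¹ : ℚˣ) : ℚ) = 1 / 2 := by rw [Units.val_inv_eq_inv_val, hu₂, Units.val_mk0]; ring
  set C : VariableChange ℚ := ⟨u₂, 0, 0, 16⟩ with hC
  have c₁ : (C • Xd).a₁ = 0 := by rw [hC, variableChange_a₁, hA₁, hu₂inv]; ring
  have c₂ : 2 ^ 2 * (C • Xd).a₂ = Xd.a₂ := by rw [hC, variableChange_a₂, hA₁, hu₂inv]; ring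
  have c₃ : (C • Xd).a₃ = 4 := by rw [hC, variableChange_a₃, hA₁, hA₃, hu₂inv]; ring
  have c₄ : 2 ^ 4 * (C • Xd).a₄ = Xd.a₄ := by rw [hC, variableChange_a₄, hA₁, hA₃, hu₂inv]; ring
  have c₆ : 2 ^ 6 * (C • Xd).a₆ = Xd.a₆ - 256 := by rw [hC, variableChange_a₆, hA₁, hA₃, hu₂inv]; ring
  have cΔ : 2 ^ 12 * (C • Xd).Δ = Xd.Δ := by rw [hC, variableChange_Δ, hu₂inv]; ring
  have fromQ : ∀ {y z : ℚ} (n : ℕ) {g : WithZero (Multiplicative ℤ)},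
      (2 : ℚ) ^ n * y = z → Valued.v (φ z) ≤ exp (-(n : ℤ)) * g → v.valuation ℚ y ≤ g := by
    intro y z n g hyz hz
    rw [hval]
    refine hscale n ?_
    have : (2 : Kv) ^ n * φ y = φ z := by rw [← hyz, map_mul, map_pow, map_ofNat]
    rw [this]; exact hz
  have fromQ' : ∀ {y z : ℚ} (n : ℕ) {g : WithZero (Multiplicative ℤ)},
      (2 : ℚ) ^ n * y = z → Valued.v (φ z) = exp (-(n : ℤ)) * g → v.valuation ℚ y = g := by
    intro y z n g hyz hz
    rw [hval]
    refine hscale' n ?_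
    have : (2 : Kv) ^ n * φ y = φ z := by rw [← hyz, map_mul, map_pow, map_ofNat]
    rw [this]; exact hz
  refine ⟨C, ?_, ?_, ?_, ?_, ?_, ?_⟩
  · rw [c₁, Valuation.map_zero]; exact zero_le
  · refine fromQ 2 c₂ ?_
    rw [hA₂, Valuation.map_mul, hpow, Valuation.map_mul, hεv, one_mul, Nat.cast_ofNat,
      show exp (-(2 : ℕ) : ℤ) = exp (-1 : ℤ) * exp (-1 : ℤ) by rw [← exp_add]; norm_num, ← mul_assoc]
    refine mul_le_mul' ?_ hαP
    rw [← exp_add]; exact hexp (by norm_num)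
  · rw [c₃, hval, map_ofNat, show (4 : Kv) = 2 ^ 2 by norm_num, hpow]
  · refine fromQ 4 c₄ ?_
    rw [hA₄, Valuation.map_mul, hpow]
    have hst : Valued.v (q + 2 ^ 2 * α₁ * θ) ≤ 1 := by
      refine Valuation.map_add_le _ hqv ?_
      rw [Valuation.map_mul, Valuation.map_mul, hpow]
      calc exp (-((2 : ℕ) : ℤ)) * Valued.v α₁ * Valued.v θ ≤ exp (-((2 : ℕ) : ℤ)) * 1 * 1 :=
            mul_le_mul' (mul_le_mul' le_rfl hα₁v) hθv
        _ ≤ 1 := by rw [mul_one, mul_one, ← exp_zero]; exact hexp (by norm_num)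
    refine (mul_le_mul' le_rfl hst).trans ?_
    push_cast
    rw [mul_one, ← exp_add]; exact hexp (by norm_num)
  · refine fromQ 6 c₆ ?_
    rw [map_sub, map_ofNat, hA₆,
      show (2 : Kv) ^ 8 * (ε * r + 2 ^ 5 * ε * θ ^ 2) - 256 = 2 ^ 8 * (ε * (r - ε) + 2 ^ 5 * ε * θ ^ 2) by
        linear_combination (2 : Kv) ^ 8 * hεK,
      Valuation.map_mul, hpow]
    push_cast
    rw [show exp (-6 : ℤ) * exp (-4 : ℤ) = exp (-8 : ℤ) * exp (-2 : ℤ) by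
        rw [← exp_add, ← exp_add]; norm_num]
    refine mul_le_mul' le_rfl (Valuation.map_add_le _ ?_ ?_)
    · rw [Valuation.map_mul, hεv, one_mul]; exact hrε
    · rw [Valuation.map_mul, Valuation.map_mul, hpow, hεv, mul_one, Valuation.map_pow]
      calc exp (-((5 : ℕ) : ℤ)) * Valued.v θ ^ 2 ≤ exp (-((5 : ℕ) : ℤ)) * 1 ^ 2 :=
            mul_le_mul' le_rfl (pow_le_pow_left' hθv 2)
        _ ≤ exp (-2 : ℤ) := by rw [one_pow, mul_one]; exact hexp (by norm_num)
  · refine fromQ' 12 cΔ ?_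
    rw [hΔd, Valuation.map_mul, hpow, ← hval, hΔ, Nat.cast_ofNat, ← exp_add, ← exp_add]
    norm_num

end WeierstrassCurve

namespace WeierstrassCurve

open Literature.NumberTheory.EllipticCurves Literature.NumberTheory.GaloisRepresentations
  Literature.NumberTheory.DiophantineGeometry Literature.NumberTheory.DiophantineGeometry.TateAlgorithm
  IsDedekindDomain.HeightOneSpectrum Rat.HeightOneSpectrum

variable (W : WeierstrassCurve ℚ)

/-- **Type `II*` with `ord₂ Δ_min = 14` over `ℚ`: a `ℚ`-model with `ord₂(a₁) ≥ 2`, `ord₂(a₂) ≥ 2`,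
`ord₂(a₃) ≥ 6`, `ord₂(a₄) ≥ 5`, `ord₂(a₆) = 5`, `ord₂(Δ) = 14`, the dichotomy `ord₂(b₈) ≥ 10`
(`Φ = C₆`) or `ord₂(b₈) = 9`, and the sign `128 ∣ a₆ - 32` or `128 ∣ a₆ + 32`** (the canonical
normal form of `exists_smul_a_of_kodairaSymbolOfMinimal_eq_IIstar_of_two_of_addVal_eq_fourteen` made
`ℚ`-rational by `exists_variableChange_valuation_shape_of_two`; `a₆/32` is a `2`-adic unit, hence
`≡ ±1 (mod 4)`). [cite: SilvermanATAEC1994, IV.9.4 Steps 6–10 and Table 4.1] -/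
theorem exists_variableChange_of_kodairaSymbolAt_IIstar_of_ordMinimalDiscriminant_eq_fourteen
    [W.IsElliptic] {v : HeightOneSpectrum (𝓞 ℚ)} (hv : (2 : 𝓞 ℚ) ∈ v.asIdeal)
    (hT : W.kodairaSymbolAt v = .IIstar) (hord : W.ordMinimalDiscriminant v = 14) :
    ∃ C : VariableChange ℚ,
      v.valuation ℚ (C • W).a₁ ≤ exp (-2 : ℤ) ∧ v.valuation ℚ (C • W).a₂ ≤ exp (-2 : ℤ) ∧
      v.valuation ℚ (C • W).a₃ ≤ exp (-6 : ℤ) ∧ v.valuation ℚ (C • W).a₄ ≤ exp (-5 : ℤ) ∧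
      v.valuation ℚ (C • W).a₆ = exp (-5 : ℤ) ∧ v.valuation ℚ (C • W).Δ = exp (-14 : ℤ) ∧
      (v.valuation ℚ (C • W).b₈ ≤ exp (-10 : ℤ) ∨ v.valuation ℚ (C • W).b₈ = exp (-9 : ℤ)) ∧
      (v.valuation ℚ ((C • W).a₆ - 32) ≤ exp (-7 : ℤ) ∨ v.valuation ℚ ((C • W).a₆ + 32) ≤ exp (-7 : ℤ)) := by
  have h2 := Rat.valuation_two_of_two_mem hv
  have h2irr := irreducible_two_adicCompletionIntegers v h2
  have hT' := hT
  rw [kodairaSymbolAt_def] at hT'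
  have hΔ14 : (IsDiscreteValuationRing.addVal (v.adicCompletionIntegers ℚ)
      (W.localMinimalIntegralModel v).Δ).toNat = 14 := by
    rw [← hord, ordMinimalDiscriminant]
  obtain ⟨D, ha₁, ha₂, ha₃, ha₄, ⟨r, hr, ha₆⟩, hb₈, hΔ⟩ :=
    LocalIndex.exists_smul_a_of_kodairaSymbolOfMinimal_eq_IIstar_of_two_of_addVal_eq_fourteen h2irr _
      hT' hΔ14
  have ha₃' : (2 : v.adicCompletionIntegers ℚ) ^ 6 ∣ (D • W.localMinimalIntegralModel v).a₃ := by
    rw [ha₃]; exact dvd_zero _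
  have ha₆c : (2 : v.adicCompletionIntegers ℚ) ^ 0 ∣ ((D • W.localMinimalIntegralModel v).a₆ - (0 : ℤ)) :=
    ⟨_, (one_mul _).symm⟩
  have hb₈9 : (2 : v.adicCompletionIntegers ℚ) ^ 9 ∣ (D • W.localMinimalIntegralModel v).b₈ := by
    rcases hb₈ with ⟨w, hw⟩ | ⟨w, -, hw⟩
    · exact ⟨2 * w, by rw [hw]; ring⟩
    · exact ⟨w, hw⟩
  have finish : ∀ C : VariableChange ℚ,
      v.valuation ℚ (C • W).a₆ = exp (-5 : ℤ) →
      (v.valuation ℚ ((C • W).a₆ - 32) ≤ exp (-7 : ℤ) ∨ v.valuation ℚ ((C • W).a₆ + 32) ≤ exp (-7 : ℤ)) :=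
    fun C h ↦ by
      have := Rat.valuation_sub_two_pow_le_or_of_valuation_eq hv 5 (by simpa using h)
      norm_num at this
      exact this
  rcases hb₈ with hb₈ | ⟨w, hw, hb₈⟩
  · obtain ⟨-, C, h₁, h₂', h₃, -, h₄, h₆, -, h₈, -, hΔ'⟩ := W.exists_variableChange_valuation_shape_of_two v h2
      (k₁ := 2) (k₂ := 2) (k₃ := 6) (k₄ := 5) (k₆ := 5) (k₈ := 10) (n := 14) D
      ha₁ ha₂ ha₃' ha₄ ⟨r, hr, ha₆⟩ 0 ha₆c hb₈ hΔ
    exact ⟨C, by simpa using h₁, by simpa using h₂', by simpa using h₃, by simpa using h₄,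
      by simpa using h₆, by simpa using hΔ', Or.inl (by simpa using h₈), finish C (by simpa using h₆)⟩
  · obtain ⟨-, C, h₁, h₂', h₃, -, h₄, h₆, -, -, h₈, hΔ'⟩ := W.exists_variableChange_valuation_shape_of_two v h2
      (k₁ := 2) (k₂ := 2) (k₃ := 6) (k₄ := 5) (k₆ := 5) (k₈ := 9) (n := 14) D
      ha₁ ha₂ ha₃' ha₄ ⟨r, hr, ha₆⟩ 0 ha₆c hb₈9 hΔ
    exact ⟨C, by simpa using h₁, by simpa using h₂', by simpa using h₃, by simpa using h₄,
      by simpa using h₆, by simpa using hΔ', Or.inr (by simpa using h₈ hw hb₈), finish C (by simpa using h₆)⟩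

/-- **The twist by `2ε` of a `C₆`-curve of type `II*`, `ord₂ Δ_min = 14`, `a₆ ≡ 32ε (mod 128)`, is
potentially good over `ℚ(∛2)`** (the type-`IV*` shape of `(2; 0, 0, 16) • (C • W)^{(2ε)}`,
`exists_variableChange_quadraticTwist_two_mul_of_IIstar_fourteen_of_valuation_b₈_le`, transported to
`W^{(2ε)}` by `quadraticTwist_smul`; `hasGoodReductionAt_baseChange_of_pow_three_eq` with `j = 2`).
[cite: SilvermanATAEC1994, IV.9.4 Steps 6–8; proof of Thm. IV.10.2(b) (PDF pp. 359–361)]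
[cite: SilvermanAEC2009, VII.5 Prop. 5.4, X.5 Cor. 5.4] -/
theorem hasGoodReductionAt_baseChange_quadraticTwist_two_mul_of_IIstar_fourteen_of_valuation_b₈_le
    {v : HeightOneSpectrum (𝓞 ℚ)} (hv : (2 : 𝓞 ℚ) ∈ v.asIdeal) {ε : ℤ} (hε : ε = 1 ∨ ε = -1)
    (C : VariableChange ℚ)
    (h₁ : v.valuation ℚ (C • W).a₁ ≤ exp (-2 : ℤ)) (h₂ : v.valuation ℚ (C • W).a₂ ≤ exp (-2 : ℤ))
    (h₃ : v.valuation ℚ (C • W).a₃ ≤ exp (-6 : ℤ)) (h₄ : v.valuation ℚ (C • W).a₄ ≤ exp (-5 : ℤ))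
    (h₆ : v.valuation ℚ (C • W).a₆ = exp (-5 : ℤ))
    (h₆ε : v.valuation ℚ ((C • W).a₆ - 32 * ε) ≤ exp (-7 : ℤ))
    (h₈ : v.valuation ℚ (C • W).b₈ ≤ exp (-10 : ℤ)) (hΔ : v.valuation ℚ (C • W).Δ = exp (-14 : ℤ))
    (L : Type*) [Field L] [NumberField L] [Algebra ℚ L] {β : L} (hβ : β ^ 3 = 2)
    {w : HeightOneSpectrum (𝓞 L)} (hw : w.asIdeal.under (𝓞 ℚ) = v.asIdeal) :
    ((W.quadraticTwist (2 * ε)).baseChange L).HasGoodReductionAt w := by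
  obtain ⟨C', g₁, g₂, g₃, g₄, g₆, gΔ⟩ :=
    (C • W).exists_variableChange_quadraticTwist_two_mul_of_IIstar_fourteen_of_valuation_b₈_le hv hε h₁
      h₂ h₃ h₄ h₆ h₆ε h₈ hΔ
  have htw : (C • W).quadraticTwist (2 * ε) =
      (⟨C.u, (2 * ε) * C.r, 0, 0⟩ : VariableChange ℚ) • W.quadraticTwist (2 * ε) := by
    exact_mod_cast quadraticTwist_smul W C ((2 * ε : ℤ) : ℚ)
  rw [htw, ← mul_smul] at g₁ g₂ g₃ g₄ g₆ gΔ
  have hβ' : β ^ 3 = algebraMap ℚ L 2 := by rw [hβ, map_ofNat]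
  exact (W.quadraticTwist (2 * ε)).hasGoodReductionAt_baseChange_of_pow_three_eq L
    (Rat.valuation_two_of_two_mem hv) hβ' 2 _ g₁ g₂ g₃ g₄ g₆ gΔ
    (by norm_num) (by norm_num) (by norm_num) (by norm_num) (by norm_num) (by norm_num) hw

variable (ℓ : ℕ) [Fact ℓ.Prime]

/-- **`Sw_𝔓(V_ℓ E) = 4` for the `C₆`-curves of type `II*`, `ord₂ Δ_min = 14`** (`ℓ ≠ 2`, `𝔓 ∣ 2`):
with `a₆ ≡ 32ε (mod 128)`, `E^{(2ε)}` is potentially good over `ℚ(∛2)`, and the break of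
`ℚ₂(√(2ε))` is `2` (`swanConductorAt_rationalTate_eq_four_of_quadraticTwist_of_emod_four_eq_two`).
Silverman, *ATAEC* IV.9 Table 4.1 (type `II*`, `f = 6`, `ord₂ Δ = 14`) with Thm. IV.10.2(b).
[cite: SilvermanATAEC1994, IV.9 Table 4.1, Thm. IV.10.2(b) (PDF pp. 358–361)] [cite: SerreTate1968, §3] -/
theorem swanConductorAt_rationalTate_eq_four_of_IIstar_fourteen_of_valuation_b₈_le [W.IsElliptic]
    (h : Continuous fun x : absoluteGaloisGroup ℚ × RationalTateModule (geomPoints W) ℓ ↦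
      rationalTateRepresentation (absoluteGaloisGroup ℚ) (geomPoints W) ℓ x.1 x.2)
    {v : HeightOneSpectrum (𝓞 ℚ)} (hv : (2 : 𝓞 ℚ) ∈ v.asIdeal) (hℓ : (ℓ : 𝓞 ℚ) ∉ v.asIdeal)
    {ε : ℤ} (hε : ε = 1 ∨ ε = -1) (C : VariableChange ℚ)
    (h₁ : v.valuation ℚ (C • W).a₁ ≤ exp (-2 : ℤ)) (h₂ : v.valuation ℚ (C • W).a₂ ≤ exp (-2 : ℤ))
    (h₃ : v.valuation ℚ (C • W).a₃ ≤ exp (-6 : ℤ)) (h₄ : v.valuation ℚ (C • W).a₄ ≤ exp (-5 : ℤ))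
    (h₆ : v.valuation ℚ (C • W).a₆ = exp (-5 : ℤ))
    (h₆ε : v.valuation ℚ ((C • W).a₆ - 32 * ε) ≤ exp (-7 : ℤ))
    (h₈ : v.valuation ℚ (C • W).b₈ ≤ exp (-10 : ℤ)) (hΔ : v.valuation ℚ (C • W).Δ = exp (-14 : ℤ))
    {𝔓 : Ideal (absIntegers (𝓞 ℚ) ℚ)} (h𝔓 : 𝔓 ∈ v.primesAbove) :
    (rationalTateGaloisRepOf (geomPoints W) ℓ h).swanConductorAt (𝓞 ℚ) 𝔓 = 4 := by
  have hd : (2 * ε) % 4 = 2 := by rcases hε with rfl | rfl <;> decide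
  exact W.swanConductorAt_rationalTate_eq_four_of_quadraticTwist_of_emod_four_eq_two ℓ h hv hℓ hd
    (fun L _ _ _ β hβ w hw ↦ by
      have := W.hasGoodReductionAt_baseChange_quadraticTwist_two_mul_of_IIstar_fourteen_of_valuation_b₈_le
        hv hε C h₁ h₂ h₃ h₄ h₆ h₆ε h₈ hΔ L hβ hw
      simpa using this)
    h𝔓

attribute [local instance] AddSubgroup.torsionBy.zmodModule in
/-- **Ogg's formula at `2` for the `C₆`-curves of type `II*`, `ord₂ Δ_min = 14`, `3`-torsion form**:
`Sw_𝔓(E[3]) = δ₂(E)`, both sides being `4` (`δ₂ = ord₂ Δ_min - 10` for type `II*`,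
`wildConductorExponent_eq_of_kodairaSymbolAt_wild`).
[cite: SilvermanATAEC1994, §IV.10 Definition of δ(E/K) (PDF p. 358), Thm. IV.11.1 (pp. 365–366), Table 4.1]
[cite: Saito1988, Theorem 1] -/
theorem swanConductorAt_torsion_eq_wildConductorExponent_of_IIstar_fourteen_of_valuation_b₈_le
    [W.IsElliptic] {v : HeightOneSpectrum (𝓞 ℚ)} (hv : (2 : 𝓞 ℚ) ∈ v.asIdeal)
    (hT : W.kodairaSymbolAt v = .IIstar) (hord : W.ordMinimalDiscriminant v = 14)
    {ε : ℤ} (hε : ε = 1 ∨ ε = -1) (C : VariableChange ℚ)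
    (h₁ : v.valuation ℚ (C • W).a₁ ≤ exp (-2 : ℤ)) (h₂ : v.valuation ℚ (C • W).a₂ ≤ exp (-2 : ℤ))
    (h₃ : v.valuation ℚ (C • W).a₃ ≤ exp (-6 : ℤ)) (h₄ : v.valuation ℚ (C • W).a₄ ≤ exp (-5 : ℤ))
    (h₆ : v.valuation ℚ (C • W).a₆ = exp (-5 : ℤ))
    (h₆ε : v.valuation ℚ ((C • W).a₆ - 32 * ε) ≤ exp (-7 : ℤ))
    (h₈ : v.valuation ℚ (C • W).b₈ ≤ exp (-10 : ℤ)) (hΔ : v.valuation ℚ (C • W).Δ = exp (-14 : ℤ))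
    {𝔓 : Ideal (absIntegers (𝓞 ℚ) ℚ)} (h𝔓 : 𝔓 ∈ v.primesAbove) :
    (W.torsionGaloisRep 3).swanConductorAt (𝓞 ℚ) 𝔓 = (W.wildConductorExponent v : ℝ) := by
  haveI : Fact (Nat.Prime 3) := ⟨Nat.prime_three⟩
  have h3 : ((3 : ℕ) : 𝓞 ℚ) ∉ v.asIdeal := by
    intro h3
    apply (Ideal.ne_top_iff_one v.asIdeal).mp v.isPrime.ne_top
    have := v.asIdeal.sub_mem h3 hv
    rwa [show ((3 : ℕ) : 𝓞 ℚ) - 2 = 1 by norm_num] at this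
  rw [← W.swanConductorAt_rationalTate_eq_swanConductorAt_torsion 3
    (W.continuous_rationalGaloisRepTate_holds 3) h3 h𝔓,
    W.swanConductorAt_rationalTate_eq_four_of_IIstar_fourteen_of_valuation_b₈_le 3 _ hv h3 hε C h₁ h₂ h₃
      h₄ h₆ h₆ε h₈ hΔ h𝔓,
    W.wildConductorExponent_eq_of_kodairaSymbolAt_wild v (Or.inr (Or.inr (Or.inr ⟨hT, rfl⟩))), hord]
  norm_num

end WeierstrassCurve


/-! ## §3. Over `ℚ`: every curve of type `II*` with `ord₂ Δ_min = 12` (`Φ = C₂`: `Sw = 2 = δ`) -/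

namespace WeierstrassCurve

open Literature.NumberTheory.EllipticCurves Literature.NumberTheory.GaloisRepresentations
  IsDedekindDomain.HeightOneSpectrum Rat.HeightOneSpectrum

variable (X : WeierstrassCurve ℚ)

/-- **The twist by `-1` of a curve of type `II*` with `ord₂ Δ = 12` has good reduction at `2`.**  Let
`X/ℚ` have `ord₂(a₁) ≥ 2`, `ord₂(a₂) ≥ 2`, `ord₂(a₃) = 3`, `ord₂(a₄) ≥ 4`, `ord₂(a₆) = 5`, `ord₂(Δ) = 12`
(the canonical normal form).  Write `a₁ = 4α₁`, `a₂ = 4P`, `a₃ = 8γ`, `a₄ = 16q`, `a₆ = 32r` (`γ, r`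
units).  The twist `X^{(-1)} : y² = x³ - 4(α₁² + P)x² + 16(q + α₁γ)x - 16(γ² + 2r)` under
`(u; r, s, t) = (2; 0, 0, 4)` becomes `a₁' = 0`, `a₂' = -(α₁² + P)`, `a₃' = 1`, `a₄' = q + α₁γ`,
`a₆' = -((γ² - 1) + 2(r + 1))/4 ∈ ℤ₂` (`γ² ≡ 1 (mod 8)`, `r` odd), `Δ' = Δ/2¹²` a unit: a `2`-integral
model with good reduction (so the curves of type `II*` with `ord₂ Δ_min = 12` are twists by `χ₋₁` of
curves with good reduction at `2`; Silverman *ATAEC* Table 4.1, `f = 4`). [cite: SilvermanATAEC1994, IV.9 Table 4.1] [cite: SilvermanAEC2009, VII.5 Prop. 5.1, X.5 Cor. 5.4] -/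
theorem exists_variableChange_quadraticTwist_neg_one_of_IIstar_twelve
    {v : HeightOneSpectrum (𝓞 ℚ)} (hv : (2 : 𝓞 ℚ) ∈ v.asIdeal)
    (h₁ : v.valuation ℚ X.a₁ ≤ exp (-2 : ℤ)) (h₂ : v.valuation ℚ X.a₂ ≤ exp (-2 : ℤ))
    (h₃ : v.valuation ℚ X.a₃ = exp (-3 : ℤ)) (h₄ : v.valuation ℚ X.a₄ ≤ exp (-4 : ℤ))
    (h₆ : v.valuation ℚ X.a₆ = exp (-5 : ℤ)) (hΔ : v.valuation ℚ X.Δ = exp (-12 : ℤ)) :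
    ∃ C : VariableChange ℚ,
      v.valuation ℚ (C • X.quadraticTwist (-1)).a₁ ≤ exp (-(0 : ℕ) : ℤ) ∧
      v.valuation ℚ (C • X.quadraticTwist (-1)).a₂ ≤ exp (-(0 : ℕ) : ℤ) ∧
      v.valuation ℚ (C • X.quadraticTwist (-1)).a₃ ≤ exp (-(0 : ℕ) : ℤ) ∧
      v.valuation ℚ (C • X.quadraticTwist (-1)).a₄ ≤ exp (-(0 : ℕ) : ℤ) ∧
      v.valuation ℚ (C • X.quadraticTwist (-1)).a₆ ≤ exp (-(0 : ℕ) : ℤ) ∧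
      v.valuation ℚ (C • X.quadraticTwist (-1)).Δ = exp (-(0 : ℕ) : ℤ) := by
  have hv2 : natGenerator v = 2 := Rat.natGenerator_eq_two hv
  set Kv := v.adicCompletion ℚ with hKv
  set φ := algebraMap ℚ Kv with hφ
  have hval : ∀ x : ℚ, v.valuation ℚ x = Valued.v (φ x) := fun x ↦ by
    rw [hφ, valued_algebraMap_adicCompletion]
  have V2 : Valued.v (2 : Kv) = exp (-1 : ℤ) := valued_two v hv2
  have h20 : (2 : Kv) ≠ 0 := by
    intro h; rw [h, Valuation.map_zero] at V2; exact exp_ne_zero V2.symm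
  have hpow : ∀ n : ℕ, Valued.v ((2 : Kv) ^ n) = exp (-(n : ℤ)) := fun n ↦ by
    rw [Valuation.map_pow, V2, ← exp_nsmul]; simp
  have hpow0 : ∀ n : ℕ, ((2 : Kv) ^ n) ≠ 0 := fun n ↦ pow_ne_zero n h20
  have hexp : ∀ {a b : ℤ}, a ≤ b → exp a ≤ exp b := fun h ↦ exp_le_exp.mpr h
  have hscale : ∀ {x : Kv} (n : ℕ) {g : WithZero (Multiplicative ℤ)},
      Valued.v (2 ^ n * x) ≤ exp (-(n : ℤ)) * g → Valued.v x ≤ g := by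
    intro x n g h
    rw [show Valued.v x = Valued.v (2 ^ n * x) / exp (-(n : ℤ)) by
      rw [Valuation.map_mul, hpow, mul_div_cancel_left₀ _ exp_ne_zero],
      div_le_iff₀ (zero_lt_iff.mpr exp_ne_zero)]
    exact h.trans_eq (mul_comm _ _)
  have hscale' : ∀ {x : Kv} (n : ℕ) {g : WithZero (Multiplicative ℤ)},
      Valued.v (2 ^ n * x) = exp (-(n : ℤ)) * g → Valued.v x = g := by
    intro x n g h
    rw [show Valued.v x = Valued.v (2 ^ n * x) / exp (-(n : ℤ)) by
      rw [Valuation.map_mul, hpow, mul_div_cancel_left₀ _ exp_ne_zero],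
      div_eq_iff exp_ne_zero]
    exact h.trans (mul_comm _ _)
  -- `a₁ = 4α₁`, `a₂ = 4P`, `a₃ = 8γ`, `a₄ = 16q`, `a₆ = 32r`
  set α₁ : Kv := φ X.a₁ / 2 ^ 2 with hα₁
  set P : Kv := φ X.a₂ / 2 ^ 2 with hP
  set γ : Kv := φ X.a₃ / 2 ^ 3 with hγ
  set q : Kv := φ X.a₄ / 2 ^ 4 with hq
  set r : Kv := φ X.a₆ / 2 ^ 5 with hr
  have ha₁ : φ X.a₁ = 2 ^ 2 * α₁ := by rw [hα₁, mul_div_cancel₀ _ (hpow0 2)]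
  have ha₂ : φ X.a₂ = 2 ^ 2 * P := by rw [hP, mul_div_cancel₀ _ (hpow0 2)]
  have ha₃ : φ X.a₃ = 2 ^ 3 * γ := by rw [hγ, mul_div_cancel₀ _ (hpow0 3)]
  have ha₄ : φ X.a₄ = 2 ^ 4 * q := by rw [hq, mul_div_cancel₀ _ (hpow0 4)]
  have ha₆ : φ X.a₆ = 2 ^ 5 * r := by rw [hr, mul_div_cancel₀ _ (hpow0 5)]
  have hα₁v : Valued.v α₁ ≤ 1 := hscale 2 (by rw [← ha₁, ← hval, mul_one]; exact h₁)
  have hPv : Valued.v P ≤ 1 := hscale 2 (by rw [← ha₂, ← hval, mul_one]; exact h₂)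
  have hγv : Valued.v γ = 1 := hscale' 3 (by rw [← ha₃, ← hval, mul_one]; exact h₃)
  have hqv : Valued.v q ≤ 1 := hscale 4 (by rw [← ha₄, ← hval, mul_one]; exact h₄)
  have hrv : Valued.v r = 1 := hscale' 5 (by rw [← ha₆, ← hval, mul_one]; exact h₆)
  -- `2`-adic congruences
  have hunit : ∀ {x : Kv}, Valued.v x = 1 → Valued.v (x - 1) ≤ exp (-1 : ℤ) := fun {x} hx ↦
    valued_le_exp_neg_one_of_lt_one v
      ((valued_lt_one_or_valued_sub_one_lt_one v hv2 hx.le).resolve_left (by rw [hx]; exact lt_irrefl 1))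
  have hγsq : Valued.v (γ ^ 2 - 1) ≤ exp (-3 : ℤ) := valued_sq_sub_one_le_of_valued_eq_one v hv2 hγv
  have hr1 : Valued.v (r + 1) ≤ exp (-1 : ℤ) := by
    have e : r + 1 = (r - 1) + 2 := by ring
    rw [e]; exact Valuation.map_add_le _ (hunit hrv) V2.le
  -- the coefficients of `Xm = X.quadraticTwist (-1)` in `K_v`
  set Xm := X.quadraticTwist (-1) with hXm
  have hA₁ : Xm.a₁ = 0 := rfl
  have hA₃ : Xm.a₃ = 0 := rfl
  have h4Q : (4 : ℚ) ≠ 0 := by norm_num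
  have h2Q : (2 : ℚ) ≠ 0 := two_ne_zero
  have hA₂ : φ Xm.a₂ = -(2 ^ 2 * (α₁ ^ 2 + P)) := by
    have e : 4 * Xm.a₂ = (-1) * X.b₂ := by
      rw [hXm, quadraticTwist_a₂, mul_div_cancel₀ _ h4Q]
    have e' := congrArg φ e
    simp only [WeierstrassCurve.b₂, map_mul, map_add, map_pow, map_ofNat, map_neg, map_one] at e'
    rw [ha₁, ha₂] at e'
    apply mul_left_cancel₀ (hpow0 2)
    linear_combination e'
  have hA₄ : φ Xm.a₄ = 2 ^ 4 * (q + α₁ * γ) := by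
    have e : 2 * Xm.a₄ = (-1) ^ 2 * X.b₄ := by
      rw [hXm, quadraticTwist_a₄, mul_div_cancel₀ _ h2Q]
    have e' := congrArg φ e
    simp only [WeierstrassCurve.b₄, map_mul, map_add, map_pow, map_ofNat, map_neg, map_one] at e'
    rw [ha₁, ha₃, ha₄] at e'
    apply mul_left_cancel₀ h20
    linear_combination e'
  have hA₆ : φ Xm.a₆ = -(2 ^ 4 * (γ ^ 2 + 2 * r)) := by
    have e : 4 * Xm.a₆ = (-1) ^ 3 * X.b₆ := by
      rw [hXm, quadraticTwist_a₆, mul_div_cancel₀ _ h4Q]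
    have e' := congrArg φ e
    simp only [WeierstrassCurve.b₆, map_mul, map_add, map_pow, map_ofNat, map_neg, map_one] at e'
    rw [ha₃, ha₆] at e'
    apply mul_left_cancel₀ (hpow0 2)
    linear_combination e'
  have hΔm : Xm.Δ = X.Δ := by rw [hXm, quadraticTwist_Δ]; norm_num
  -- the change of variables `(2; 0, 0, 4)`
  set u₂ : ℚˣ := Units.mk0 2 h2Q with hu₂
  have hu₂inv : ((u₂⁻¹ : ℚˣ) : ℚ) = 1 / 2 := by rw [Units.val_inv_eq_inv_val, hu₂, Units.val_mk0]; ring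
  set C : VariableChange ℚ := ⟨u₂, 0, 0, 4⟩ with hC
  have c₁ : (C • Xm).a₁ = 0 := by rw [hC, variableChange_a₁, hA₁, hu₂inv]; ring
  have c₂ : 2 ^ 2 * (C • Xm).a₂ = Xm.a₂ := by rw [hC, variableChange_a₂, hA₁, hu₂inv]; ring
  have c₃ : (C • Xm).a₃ = 1 := by rw [hC, variableChange_a₃, hA₁, hA₃, hu₂inv]; ring
  have c₄ : 2 ^ 4 * (C • Xm).a₄ = Xm.a₄ := by rw [hC, variableChange_a₄, hA₁, hA₃, hu₂inv]; ring
  have c₆ : 2 ^ 6 * (C • Xm).a₆ = Xm.a₆ - 16 := by rw [hC, variableChange_a₆, hA₁, hA₃, hu₂inv]; ring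
  have cΔ : 2 ^ 12 * (C • Xm).Δ = X.Δ := by rw [hC, variableChange_Δ, hu₂inv, hΔm]; ring
  have fromQ : ∀ {y z : ℚ} (n : ℕ) {g : WithZero (Multiplicative ℤ)},
      (2 : ℚ) ^ n * y = z → Valued.v (φ z) ≤ exp (-(n : ℤ)) * g → v.valuation ℚ y ≤ g := by
    intro y z n g hyz hz
    rw [hval]
    refine hscale n ?_
    have : (2 : Kv) ^ n * φ y = φ z := by rw [← hyz, map_mul, map_pow, map_ofNat]
    rw [this]; exact hz
  have fromQ' : ∀ {y z : ℚ} (n : ℕ) {g : WithZero (Multiplicative ℤ)},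
      (2 : ℚ) ^ n * y = z → Valued.v (φ z) = exp (-(n : ℤ)) * g → v.valuation ℚ y = g := by
    intro y z n g hyz hz
    rw [hval]
    refine hscale' n ?_
    have : (2 : Kv) ^ n * φ y = φ z := by rw [← hyz, map_mul, map_pow, map_ofNat]
    rw [this]; exact hz
  have e0 : exp (-((0 : ℕ) : ℤ)) = 1 := by simp
  refine ⟨C, ?_, ?_, ?_, ?_, ?_, ?_⟩
  · rw [c₁, Valuation.map_zero]; exact zero_le
  · refine fromQ 2 c₂ ?_
    rw [hA₂, Valuation.map_neg, Valuation.map_mul, hpow, e0, mul_one]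
    refine mul_le_mul' le_rfl (Valuation.map_add_le _ ?_ hPv)
    rw [Valuation.map_pow]; exact pow_le_one' hα₁v 2
  · rw [c₃, e0, Valuation.map_one]
  · refine fromQ 4 c₄ ?_
    rw [hA₄, Valuation.map_mul, hpow, e0, mul_one]
    refine mul_le_mul' le_rfl (Valuation.map_add_le _ hqv ?_)
    rw [Valuation.map_mul, hγv, mul_one]; exact hα₁v
  · refine fromQ 6 c₆ ?_
    rw [map_sub, map_ofNat, hA₆, e0, mul_one,
      show -((2 : Kv) ^ 4 * (γ ^ 2 + 2 * r)) - 16 = -(2 ^ 4 * ((γ ^ 2 - 1) + 2 * (r + 1))) by ring,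
      Valuation.map_neg, Valuation.map_mul, hpow,
      show exp (-((6 : ℕ) : ℤ)) = exp (-((4 : ℕ) : ℤ)) * exp (-2 : ℤ) by rw [← exp_add]; norm_num]
    refine mul_le_mul' le_rfl (Valuation.map_add_le _ (hγsq.trans (hexp (by norm_num))) ?_)
    rw [Valuation.map_mul, V2, show exp (-2 : ℤ) = exp (-1 : ℤ) * exp (-1 : ℤ) by rw [← exp_add]; norm_num]
    exact mul_le_mul' le_rfl hr1
  · refine fromQ' 12 cΔ ?_
    rw [← hval, hΔ, e0, mul_one]; norm_num

end WeierstrassCurve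

namespace WeierstrassCurve

open Literature.NumberTheory.EllipticCurves Literature.NumberTheory.GaloisRepresentations
  Literature.NumberTheory.DiophantineGeometry Literature.NumberTheory.DiophantineGeometry.TateAlgorithm
  IsDedekindDomain.HeightOneSpectrum Rat.HeightOneSpectrum

variable (W : WeierstrassCurve ℚ)

/-- **Type `II*` with `ord₂ Δ_min = 12` over `ℚ`: a `ℚ`-model with `ord₂(a₁) ≥ 2`, `ord₂(a₂) ≥ 2`,
`ord₂(a₃) = 3`, `ord₂(a₄) ≥ 4`, `ord₂(a₆) = 5`, `ord₂(Δ) = 12`** (the canonical normal form of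
`exists_smul_a_of_kodairaSymbolOfMinimal_eq_IIstar_of_two_of_addVal_eq_twelve` made `ℚ`-rational by
`exists_variableChange_valuation_a_b₈_of_two`). [cite: SilvermanATAEC1994, IV.9.4 Steps 6–10 and Table 4.1] -/
theorem exists_variableChange_of_kodairaSymbolAt_IIstar_of_ordMinimalDiscriminant_eq_twelve
    [W.IsElliptic] {v : HeightOneSpectrum (𝓞 ℚ)} (hv : (2 : 𝓞 ℚ) ∈ v.asIdeal)
    (hT : W.kodairaSymbolAt v = .IIstar) (hord : W.ordMinimalDiscriminant v = 12) :
    ∃ C : VariableChange ℚ,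
      v.valuation ℚ (C • W).a₁ ≤ exp (-2 : ℤ) ∧ v.valuation ℚ (C • W).a₂ ≤ exp (-2 : ℤ) ∧
      v.valuation ℚ (C • W).a₃ = exp (-3 : ℤ) ∧ v.valuation ℚ (C • W).a₄ ≤ exp (-4 : ℤ) ∧
      v.valuation ℚ (C • W).a₆ = exp (-5 : ℤ) ∧ v.valuation ℚ (C • W).Δ = exp (-12 : ℤ) := by
  have h2 := Rat.valuation_two_of_two_mem hv
  have h2irr := irreducible_two_adicCompletionIntegers v h2
  have hT' := hT
  rw [kodairaSymbolAt_def] at hT'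
  have hΔ12 : (IsDiscreteValuationRing.addVal (v.adicCompletionIntegers ℚ)
      (W.localMinimalIntegralModel v).Δ).toNat = 12 := by
    rw [← hord, ordMinimalDiscriminant]
  obtain ⟨D, ha₁, ha₂, ha₃, ha₄, ha₆, hΔ⟩ :=
    LocalIndex.exists_smul_a_of_kodairaSymbolOfMinimal_eq_IIstar_of_two_of_addVal_eq_twelve h2irr _
      hT' hΔ12
  have hb₈ : (2 : v.adicCompletionIntegers ℚ) ^ 0 ∣ (D • W.localMinimalIntegralModel v).b₈ :=
    ⟨_, (one_mul _).symm⟩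
  obtain ⟨-, C, h₁, h₂', h₃, h₄, h₆, -, -, hΔ'⟩ := W.exists_variableChange_valuation_a_b₈_of_two v h2
    (k₁ := 2) (k₂ := 2) (k₃ := 3) (k₄ := 4) (k₆ := 5) (k₈ := 0) (n := 12) D
    ha₁ ha₂ ha₃ ha₄ ha₆ hb₈ hΔ
  exact ⟨C, by simpa using h₁, by simpa using h₂', by simpa using h₃, by simpa using h₄,
    by simpa using h₆, by simpa using hΔ'⟩

/-- **Every curve of type `II*` with `ord₂ Δ_min = 12` over `ℚ` is the twist by `-1` of a curve with
good reduction at `2`**: with a `ℚ`-model `C • W` as above, `(2; 0, 0, 4) • (C • W)^{(-1)}` is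
`2`-integral with unit discriminant (`exists_variableChange_quadraticTwist_neg_one_of_IIstar_twelve`),
so `W^{(-1)}` has good reduction at the places above `v` of every number field (here those
containing `∛2`, the shape `j = 0` of `hasGoodReductionAt_baseChange_of_pow_three_eq`).
[cite: SilvermanATAEC1994, IV.9 Table 4.1; Thm. IV.10.2] [cite: SilvermanAEC2009, VII.5 Prop. 5.1, X.5 Cor. 5.4] -/
theorem hasGoodReductionAt_baseChange_quadraticTwist_neg_one_of_IIstar_twelve
    {v : HeightOneSpectrum (𝓞 ℚ)} (hv : (2 : 𝓞 ℚ) ∈ v.asIdeal) (C : VariableChange ℚ)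
    (h₁ : v.valuation ℚ (C • W).a₁ ≤ exp (-2 : ℤ)) (h₂ : v.valuation ℚ (C • W).a₂ ≤ exp (-2 : ℤ))
    (h₃ : v.valuation ℚ (C • W).a₃ = exp (-3 : ℤ)) (h₄ : v.valuation ℚ (C • W).a₄ ≤ exp (-4 : ℤ))
    (h₆ : v.valuation ℚ (C • W).a₆ = exp (-5 : ℤ)) (hΔ : v.valuation ℚ (C • W).Δ = exp (-12 : ℤ))
    (L : Type*) [Field L] [NumberField L] [Algebra ℚ L] {β : L} (hβ : β ^ 3 = 2)
    {w : HeightOneSpectrum (𝓞 L)} (hw : w.asIdeal.under (𝓞 ℚ) = v.asIdeal) :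
    ((W.quadraticTwist (-1)).baseChange L).HasGoodReductionAt w := by
  obtain ⟨C', g₁, g₂, g₃, g₄, g₆, gΔ⟩ :=
    (C • W).exists_variableChange_quadraticTwist_neg_one_of_IIstar_twelve hv h₁ h₂ h₃ h₄ h₆ hΔ
  have htw : (C • W).quadraticTwist (-1) =
      (⟨C.u, (-1) * C.r, 0, 0⟩ : VariableChange ℚ) • W.quadraticTwist (-1) :=
    quadraticTwist_smul W C (-1)
  rw [htw, ← mul_smul] at g₁ g₂ g₃ g₄ g₆ gΔ
  have hβ' : β ^ 3 = algebraMap ℚ L 2 := by rw [hβ, map_ofNat]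
  exact (W.quadraticTwist (-1)).hasGoodReductionAt_baseChange_of_pow_three_eq L
    (Rat.valuation_two_of_two_mem hv) hβ' 0 _ g₁ g₂ g₃ g₄ g₆ gΔ
    (by norm_num) (by norm_num) (by norm_num) (by norm_num) (by norm_num) (by norm_num) hw

variable (ℓ : ℕ) [Fact ℓ.Prime]

/-- **`Sw_𝔓(V_ℓ E) = 2` for every curve of type `II*` with `ord₂ Δ_min = 12` over `ℚ`** (`ℓ ≠ 2`,
`𝔓 ∣ 2`): `E^{(-1)}` has good reduction at `2`, and the break of `ℚ₂(√-1)` is `1`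
(`swanConductorAt_rationalTate_eq_two_of_quadraticTwist_of_emod_four_eq_three`).  Silverman, *ATAEC*
IV.9 Table 4.1 (type `II*`, `f = 4`, `ord₂ Δ = 12`) with Thm. IV.10.2.
[cite: SilvermanATAEC1994, IV.9 Table 4.1, Thm. IV.10.2 (PDF pp. 358–361)] [cite: SerreTate1968, §3] -/
theorem swanConductorAt_rationalTate_eq_two_of_IIstar_twelve [W.IsElliptic]
    (h : Continuous fun x : absoluteGaloisGroup ℚ × RationalTateModule (geomPoints W) ℓ ↦
      rationalTateRepresentation (absoluteGaloisGroup ℚ) (geomPoints W) ℓ x.1 x.2)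
    {v : HeightOneSpectrum (𝓞 ℚ)} (hv : (2 : 𝓞 ℚ) ∈ v.asIdeal) (hℓ : (ℓ : 𝓞 ℚ) ∉ v.asIdeal)
    (hT : W.kodairaSymbolAt v = .IIstar) (hord : W.ordMinimalDiscriminant v = 12)
    {𝔓 : Ideal (absIntegers (𝓞 ℚ) ℚ)} (h𝔓 : 𝔓 ∈ v.primesAbove) :
    (rationalTateGaloisRepOf (geomPoints W) ℓ h).swanConductorAt (𝓞 ℚ) 𝔓 = 2 := by
  obtain ⟨C, h₁, h₂, h₃, h₄, h₆, hΔ⟩ :=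
    W.exists_variableChange_of_kodairaSymbolAt_IIstar_of_ordMinimalDiscriminant_eq_twelve hv hT hord
  exact W.swanConductorAt_rationalTate_eq_two_of_quadraticTwist_of_emod_four_eq_three ℓ h hv hℓ
    (d := -1) (by decide)
    (fun L _ _ _ β hβ w hw ↦ by
      have := W.hasGoodReductionAt_baseChange_quadraticTwist_neg_one_of_IIstar_twelve hv C h₁ h₂ h₃ h₄
        h₆ hΔ L hβ hw
      simpa using this)
    h𝔓

attribute [local instance] AddSubgroup.torsionBy.zmodModule in
/-- **Ogg's formula at `2` for every curve of type `II*` with `ord₂ Δ_min = 12` over `ℚ`, `3`-torsion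
form**: `Sw_𝔓(E[3]) = δ₂(E)`, both sides being `2` (`δ₂ = ord₂ Δ_min - 10` for type `II*`).  A complete
sub-branch of the hypothesis `H` of `conductorNatOf_geomPoints_eq_conductorNorm_of_isElliptic_of_potentiallyGood`
(no side condition).
[cite: SilvermanATAEC1994, §IV.10 Definition of δ(E/K) (PDF p. 358), Thm. IV.11.1 (pp. 365–366), Table 4.1]
[cite: Saito1988, Theorem 1] -/
theorem swanConductorAt_torsion_eq_wildConductorExponent_of_IIstar_twelve
    [W.IsElliptic] {v : HeightOneSpectrum (𝓞 ℚ)} (hv : (2 : 𝓞 ℚ) ∈ v.asIdeal)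
    (hT : W.kodairaSymbolAt v = .IIstar) (hord : W.ordMinimalDiscriminant v = 12)
    {𝔓 : Ideal (absIntegers (𝓞 ℚ) ℚ)} (h𝔓 : 𝔓 ∈ v.primesAbove) :
    (W.torsionGaloisRep 3).swanConductorAt (𝓞 ℚ) 𝔓 = (W.wildConductorExponent v : ℝ) := by
  haveI : Fact (Nat.Prime 3) := ⟨Nat.prime_three⟩
  have h3 : ((3 : ℕ) : 𝓞 ℚ) ∉ v.asIdeal := by
    intro h3
    apply (Ideal.ne_top_iff_one v.asIdeal).mp v.isPrime.ne_top
    have := v.asIdeal.sub_mem h3 hv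
    rwa [show ((3 : ℕ) : 𝓞 ℚ) - 2 = 1 by norm_num] at this
  rw [← W.swanConductorAt_rationalTate_eq_swanConductorAt_torsion 3
    (W.continuous_rationalGaloisRepTate_holds 3) h3 h𝔓,
    W.swanConductorAt_rationalTate_eq_two_of_IIstar_twelve 3 _ hv h3 hT hord h𝔓,
    W.wildConductorExponent_eq_of_kodairaSymbolAt_wild v (Or.inr (Or.inr (Or.inr ⟨hT, rfl⟩))), hord]
  norm_num

/-- **The C15 fact `N^{(ℓ)}(V_ℓ E) = N_E` for every `W / ℚ` of Kodaira type `II*` with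
`ord₂ Δ_min = 12` at `2`, every prime `ℓ`, unconditionally**: the hypothesis `H` of
`conductorNatOf_geomPoints_eq_conductorNorm_of_isElliptic_of_potentiallyGood` holds for such `W`
(`swanConductorAt_torsion_eq_wildConductorExponent_of_IIstar_twelve` at any prime above `2`).
Serre–Tate 1968 §3 with Silverman *ATAEC* §IV.10–11.
[cite: SerreTate1968, §3] [cite: SilvermanATAEC1994, §IV.10 Definition of the conductor (PDF p. 364), Thm. IV.11.1 (pp. 365–366)] -/
theorem conductorNatOf_geomPoints_eq_conductorNorm_of_isElliptic_of_IIstar_twelve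
    (hT : ∀ [W.IsElliptic],
      W.kodairaSymbolAt ((Rat.HeightOneSpectrum.primesEquiv (R := 𝓞 ℚ)).symm ⟨2, Nat.prime_two⟩) = .IIstar ∧
      W.ordMinimalDiscriminant ((Rat.HeightOneSpectrum.primesEquiv (R := 𝓞 ℚ)).symm ⟨2, Nat.prime_two⟩) =
        12) :
    W.conductorNatOf_geomPoints_eq_conductorNorm_of_isElliptic ℓ := by
  refine W.conductorNatOf_geomPoints_eq_conductorNorm_of_isElliptic_of_potentiallyGood ℓ ?_
  intro _ _ _
  obtain ⟨𝔓, h𝔓⟩ := HeightOneSpectrum.primesAbove_nonempty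
    ((Rat.HeightOneSpectrum.primesEquiv (R := 𝓞 ℚ)).symm ⟨2, Nat.prime_two⟩)
  exact ⟨𝔓, h𝔓, W.swanConductorAt_torsion_eq_wildConductorExponent_of_IIstar_twelve
    Rat.two_mem_primesEquiv_symm_two hT.1 hT.2 h𝔓⟩

end WeierstrassCurve

end
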